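import Mathlib
import HarnessLib
import Literature.Analysis.FluidPDE.SwirlTransportProofs
import Summits.NavierStokesRegularity.NavierStokesRegularity.Theorems.PoloidalWindowRigidity.Negative.CrossedSuctionLayers

/-!
# Crux `PoloidalWindowRigidity` (K2, stmt-NavierStokesRegularity-19708) — negative side:
# the vorticity of the crossed suction layers has NO continuous Euclidean symmetry (kill test K-a of line `lrc-jet`)

Negative-side support (refuter seat ns-regularity-refuter1 g3, cell ns-regularity-ideate; D-0081 §C); sequel of
`…Negative.CrossedSuctionLayers` (the flow `v = crossField a b c`: entire, steady Navier–Stokes, poloidal, constant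
Clebsch slope `1/2`).

THE LINE UNDER ATTACK.  The K2 lead's line `lrc-jet` (K2P1-LOCAL-NOTES v4 §10, LINE-PROPOSAL-lrc-jet, adopted by
DIRECTOR-NS g7 #20) rests on the LOCAL RIGIDITY CONJECTURE LRC′: «a real-analytic Navier–Stokes solution (any pressure)
on `U × I` with `(curl v)₂ ≡ 0`, `curl v ≠ 0` and Clebsch slope `Λ ∉ {0,1}` has, on every slice, a non-zero Killing
field `K` with `L_K ω = 0` on `U`» (then the settled strata (A) `…VorticityTranslate` / (A′)
`…VorticityAxisymmetricAnyAxis` finish K2).  Pre-registered kill test K-a: «a local real-analytic NS flow, `ω₂ ≡ 0`,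
`Λ ∉ {0,1}`, whose vorticity has NO Killing symmetry».

* `exists_killing_defect`: for `a, b, c ≠ 0`, NO Killing field `K(y) = Ω × (y − q) + β` with `(Ω, β) ≠ 0`
  (translations along ANY line, rotations and screw motions about ANY axis) satisfies `Dω[K] = Ω × ω` on a non-empty
  open set — `ω = curl v = (−bE₂, −aE₁ + cE₃, 0)`.  Proof: the nine scalar components of the identity at the four
  points `y, y+te₁, y+te₀, y+te₀+te₁` (`e^t ≠ 1`) force `Ω = 0`, `β = 0` (`killing_algebra`).
* Corollaries in the literal hypothesis shapes of the strata theorems: `exists_translation_defect` (`∂_e ω ≠ 0`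
  somewhere in every open set, every `e ≠ 0` — negation of the local (A)-hypothesis of `…LocalVorticitySymmetry`),
  `exists_rotation_defect` (`Dω(y)[J(y−q)] ≠ Jω(y)` somewhere in every open set, every vertical axis — negation of the
  local (A′)-hypothesis), `not_curl_translate_invariant` (`¬ ∀ y l, ω(y + l e) = ω(y)` — negation of the hypothesis
  of `…VorticityTranslate.eq_zero_of_curl_translate_eq_slice` for this steady field).

VERDICT FOR THE LINE.  K-a is met: **LRC′ as stated is false** — real-analytic (entire), poloidal, `Λ ≡ 1/2`, and the
vorticity admits no one-parameter isometry group at all, so neither stratum (A) nor (A′) contains the flow.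
Classification (an informal conjecture; no registered item is refuted): *misstated* — the witness lives on the
exceptional stratum `∇Λ ≡ 0` (constant slope), which the lead's decisive jet runs (pins with `∇Λ(0) ≠ 0`) never
visited; the minimal repair is **LRC″ = LRC′ + «Λ is not locally constant on U»**, which this witness does not bite,
and the residue assembly then needs the constant-slope hyperbolic half `{Λ ≡ λ ∈ (0,1)}` (K2-p2's H4b, which uses the
mild formulation (M)) as a separate conjunct.  The flow is unbounded: it says nothing against K2 itself or H4b.  It
also corrects §5 of the notes: `b = (Dv)_{τn} ≠ 0` here, so «vorticity is a strain eigenvector» is not necessary for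
steady poloidal flows.  (Two layers alone — `c = 0` — are 2.5-dimensional, invariant along the oblique line
`(1,1,−1)`: stratum (A) with a NON-horizontal direction; the third layer removes every symmetry.)

MECHANISM / FAMILY.  Constant-slope poloidal flows are `v = ((λ−1)∇_hP, λ∂₂P)` with `(λ−1)Δ_hP + λ∂₂²P = 0`; one
exponential layer `A â e^{κ k̂·x}`, `k̂ = (h, ±s)`, `â = ((λ−1)h, ±λs)`, `s = √((1−λ)/λ)`, `λ ∈ (0,1)`, is an exact
steady solution once the drift `c₀` obeys `c₀·k = |k|²` — the oblique form of the asymptotic-suction boundary layer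
[cite: Drazin2002, Exercise 8.27]; two layers superpose exactly iff their interaction `(a_i·k_j)a_j + (a_j·k_i)a_i` is
parallel to `k_i + k_j` (a pressure gradient), i.e. iff `(k_i + k_j)₂ = 0` or `κ_i h_i = −κ_j h_j`.  The triple
`k̂ ∈ {(h₁, εs), (−h₁, εs), (h₂, −εs)}` satisfies this pairwise for any horizontal directions `h₁ ∦ h₂`, any
`λ ∈ (0,1)`, rate `κ` and amplitudes, with drift `c₀ = (2κ/(λ sin∠(h₁,h₂))) h₁^⊥ + (κ/(ελs)) e₂`;
`…CrossedSuctionLayers` is the instance `λ = 1/2`, `κ = 1`, `h₁ = e₀`, `h₂ = e₁`, `ε = 1`, `k₁ = (1,0,1)`,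
`k₂ = (0,1,−1)`, `k₃ = (−1,0,1)`, `c₀ = (0,4,2)`.

WHAT THIS IS NOT: not a statement about Navier–Stokes regularity, not a member of the Type-I class `𝔓(C)`, not a
refutation of any registered item — a counterexample to an informal line conjecture, filed as negative knowledge for
the crux. [folklore]
-/

noncomputable section

set_option linter.dupNamespace false

namespace Summit.NavierStokesRegularity.NavierStokesRegularity.Theorems.PoloidalWindowRigidity.Negative

open Set Function Filter Topology Metric Real InnerProductSpace WithLp
open scoped Laplacian RealInnerProductSpace ContDiff
open Literature.Analysis Literature.Analysis.FluidPDE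

/-- Local notation for physical space `ℝ³ = EuclideanSpace ℝ (Fin 3)`. -/
local notation "ℝ³" => EuclideanSpace ℝ (Fin 3)

/-- Local notation for the standard basis vectors. -/
local notation "𝐞" j => EuclideanSpace.single (j : Fin 3) (1 : ℝ)

namespace CrossedLayers

variable (a b c : ℝ)

/-! ### Shifts: how the layers change under the coordinate translations used below -/

/-- `E₁(y + te₀) = e^t E₁(y)`. [folklore] -/
theorem E₁_add_single_zero (y : ℝ³) (t : ℝ) : E₁ (y + t • (𝐞 0)) = exp t * E₁ y := by
  simp [E₁, ← exp_add]; ring_nf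
/-- `E₂(y + te₀) = E₂(y)`. [folklore] -/
theorem E₂_add_single_zero (y : ℝ³) (t : ℝ) : E₂ (y + t • (𝐞 0)) = E₂ y := by
  simp [E₂]
/-- `E₃(y + te₀) = e^{-t} E₃(y)`. [folklore] -/
theorem E₃_add_single_zero (y : ℝ³) (t : ℝ) : E₃ (y + t • (𝐞 0)) = (exp t)⁻¹ * E₃ y := by
  simp [E₃, ← exp_neg, ← exp_add]; ring_nf
/-- `E₁(y + te₁) = E₁(y)`. [folklore] -/
theorem E₁_add_single_one (y : ℝ³) (t : ℝ) : E₁ (y + t • (𝐞 1)) = E₁ y := by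
  simp [E₁]
/-- `E₂(y + te₁) = e^t E₂(y)`. [folklore] -/
theorem E₂_add_single_one (y : ℝ³) (t : ℝ) : E₂ (y + t • (𝐞 1)) = exp t * E₂ y := by
  simp [E₂, ← exp_add]; ring_nf
/-- `E₃(y + te₁) = E₃(y)`. [folklore] -/
theorem E₃_add_single_one (y : ℝ³) (t : ℝ) : E₃ (y + t • (𝐞 1)) = E₃ y := by
  simp [E₃]

/-! ### The vorticity gradient -/

/-- The vorticity as a combination of the standard basis vectors. [folklore] -/
theorem vort_eq (y : ℝ³) : vort a b c y = (-b * E₂ y) • (𝐞 0) + (-a * E₁ y + c * E₃ y) • (𝐞 1) := by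
  ext i; fin_cases i <;> simp [vort]

/-- The derivative of the vorticity field. [folklore] -/
theorem hasFDerivAt_vort (y : ℝ³) : HasFDerivAt (vort a b c)
    (((-b * E₂ y) • ℓ₂).smulRight (𝐞 0) + ((-a * E₁ y) • ℓ₁ + (c * E₃ y) • ℓ₃).smulRight (𝐞 1)) y := by
  have e : vort a b c = fun y => (-b * E₂ y) • (𝐞 0) + (-a * E₁ y + c * E₃ y) • (𝐞 1) :=
    funext (vort_eq a b c)
  rw [e]
  have h0 := ((hasFDerivAt_E₂ y).const_mul (-b)).smul_const (𝐞 0)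
  have h1 := (((hasFDerivAt_E₁ y).const_mul (-a)).add ((hasFDerivAt_E₃ y).const_mul c)).smul_const (𝐞 1)
  refine (h0.add h1).congr_fderiv ?_
  ext h i
  fin_cases i
  · simp [smul_smul]
  · simp [smul_smul]
  · simp [smul_smul]

/-- `(Dω(y)h)₀ = −b E₂(y) (h₁ − h₂)`. [folklore] -/
theorem fderiv_curl_crossField_apply_zero (y h : ℝ³) :
    fderiv ℝ (curl (crossField a b c)) y h 0 = -b * E₂ y * (h 1 - h 2) := by
  rw [curl_crossField_eq, (hasFDerivAt_vort a b c y).fderiv]; simp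

/-- `(Dω(y)h)₁ = −a E₁(y) (h₀ + h₂) + c E₃(y) (h₂ − h₀)`. [folklore] -/
theorem fderiv_curl_crossField_apply_one (y h : ℝ³) :
    fderiv ℝ (curl (crossField a b c)) y h 1 = -a * E₁ y * (h 0 + h 2) + c * E₃ y * (h 2 - h 0) := by
  rw [curl_crossField_eq, (hasFDerivAt_vort a b c y).fderiv]; simp

/-- `(Dω(y)h)₂ = 0`. [folklore] -/
theorem fderiv_curl_crossField_apply_two (y h : ℝ³) :
    fderiv ℝ (curl (crossField a b c)) y h 2 = 0 := by
  rw [curl_crossField_eq, (hasFDerivAt_vort a b c y).fderiv]; simp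

/-! ### No Killing field of `ℝ³` preserves the vorticity on any open set -/

/-- Component `0` of the cross product. [folklore] -/
private theorem cross_apply_zero (u v : ℝ³) : cross u v 0 = u 1 * v 2 - u 2 * v 1 := by
  simp [cross, cross_apply]
/-- Component `1` of the cross product. [folklore] -/
private theorem cross_apply_one (u v : ℝ³) : cross u v 1 = u 2 * v 0 - u 0 * v 2 := by
  simp [cross, cross_apply]
/-- Component `2` of the cross product. [folklore] -/
private theorem cross_apply_two (u v : ℝ³) : cross u v 2 = u 0 * v 1 - u 1 * v 0 := by
  simp [cross, cross_apply]

/-- The real algebra behind `exists_killing_defect`: the nine scalar component identities of `Dω[K] = Ω × ω` at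
the four points `y, y + t e₁, y + t e₀, y + t e₀ + t e₁` (`s = e^t ≠ 1`) force `Ω = 0` and `β = 0`. [folklore] -/
private theorem killing_algebra {a b c P Q R s t Ω0 Ω1 Ω2 β0 β1 β2 y0 y1 y2 q0 q1 q2 : ℝ}
    (ha : a ≠ 0) (hb : b ≠ 0) (hc : c ≠ 0) (hP : 0 < P) (hQ : 0 < Q) (hR : 0 < R)
    (hs : 0 < s) (hs1 : s ≠ 1) (ht : t ≠ 0)
    (A2 : (0 : ℝ) = Ω0 * (-a * P + c * R) - Ω1 * (-b * Q))
    (B2 : (0 : ℝ) = Ω0 * (-a * P + c * R) - Ω1 * (-b * (s * Q)))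
    (C2 : (0 : ℝ) = Ω0 * (-a * (s * P) + c * (s⁻¹ * R)) - Ω1 * (-b * Q))
    (A0 : -b * Q * ((Ω2 * (y0 - q0) - Ω0 * (y2 - q2) + β1) - (Ω0 * (y1 - q1) - Ω1 * (y0 - q0) + β2)) =
      Ω1 * 0 - Ω2 * (-a * P + c * R))
    (B0 : -b * (s * Q) * ((Ω2 * (y0 - q0) - Ω0 * (y2 - q2) + β1) - (Ω0 * (y1 + t - q1) - Ω1 * (y0 - q0) + β2)) =
      Ω1 * 0 - Ω2 * (-a * P + c * R))
    (C0 : -b * Q * ((Ω2 * (y0 + t - q0) - Ω0 * (y2 - q2) + β1) - (Ω0 * (y1 - q1) - Ω1 * (y0 + t - q0) + β2)) =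
      Ω1 * 0 - Ω2 * (-a * (s * P) + c * (s⁻¹ * R)))
    (D0 : -b * (s * Q) *
        ((Ω2 * (y0 + t - q0) - Ω0 * (y2 - q2) + β1) - (Ω0 * (y1 + t - q1) - Ω1 * (y0 + t - q0) + β2)) =
      Ω1 * 0 - Ω2 * (-a * (s * P) + c * (s⁻¹ * R)))
    (A1 : -a * P * ((Ω1 * (y2 - q2) - Ω2 * (y1 - q1) + β0) + (Ω0 * (y1 - q1) - Ω1 * (y0 - q0) + β2)) +
        c * R * ((Ω0 * (y1 - q1) - Ω1 * (y0 - q0) + β2) - (Ω1 * (y2 - q2) - Ω2 * (y1 - q1) + β0)) =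
      Ω2 * (-b * Q) - Ω0 * 0)
    (C1 : -a * (s * P) * ((Ω1 * (y2 - q2) - Ω2 * (y1 - q1) + β0) + (Ω0 * (y1 - q1) - Ω1 * (y0 + t - q0) + β2)) +
        c * (s⁻¹ * R) * ((Ω0 * (y1 - q1) - Ω1 * (y0 + t - q0) + β2) - (Ω1 * (y2 - q2) - Ω2 * (y1 - q1) + β0)) =
      Ω2 * (-b * Q) - Ω0 * 0) :
    Ω0 = 0 ∧ Ω1 = 0 ∧ Ω2 = 0 ∧ β0 = 0 ∧ β1 = 0 ∧ β2 = 0 := by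
  have hs1' : s - 1 ≠ 0 := sub_ne_zero.mpr hs1
  have hss : 1 - s * s ≠ 0 := by
    intro h
    rcases mul_self_eq_one_iff.mp (by linarith : s * s = 1) with h' | h'
    · exact hs1 h'
    · linarith
  have hsinv : s * s⁻¹ = 1 := mul_inv_cancel₀ hs.ne'
  have hbQ : b * Q * (s - 1) ≠ 0 := mul_ne_zero (mul_ne_zero hb hQ.ne') hs1'
  -- Ω1 = 0
  have hΩ1 : Ω1 = 0 := by
    have h : Ω1 * (b * Q * (s - 1)) = 0 := by linear_combination A2 - B2
    exact (mul_eq_zero.mp h).resolve_right hbQ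
  subst hΩ1
  -- Ω0 = 0
  have hΩ0 : Ω0 = 0 := by
    by_contra h0
    have e1 : -a * P + c * R = 0 :=
      (mul_eq_zero.mp (by linear_combination -A2 : Ω0 * (-a * P + c * R) = 0)).resolve_left h0
    have e2 : -a * (s * P) + c * (s⁻¹ * R) = 0 :=
      (mul_eq_zero.mp (by linear_combination -C2 : Ω0 * (-a * (s * P) + c * (s⁻¹ * R)) = 0)).resolve_left h0
    have e3 : a * P * (1 - s * s) = 0 := by linear_combination s * e2 - e1 - (c * R) * hsinv
    rcases mul_eq_zero.mp e3 with h | h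
    · exact (mul_ne_zero ha hP.ne') h
    · exact hss h
  subst hΩ0
  -- Ω2 = 0
  have hM : Ω2 * (y0 - q0) + β1 - β2 = 0 := by
    have h : b * Q * (s - 1) * (Ω2 * (y0 - q0) + β1 - β2) = 0 := by linear_combination A0 - B0
    exact (mul_eq_zero.mp h).resolve_left hbQ
  have hΩ2 : Ω2 = 0 := by
    have h : b * Q * (s - 1) * (Ω2 * (y0 - q0) + β1 - β2 + Ω2 * t) = 0 := by linear_combination C0 - D0
    have h' : Ω2 * t = 0 := by linear_combination (mul_eq_zero.mp h).resolve_left hbQ - hM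
    exact (mul_eq_zero.mp h').resolve_right ht
  subst hΩ2
  -- β = 0
  have h12 : β1 = β2 := by
    have h : b * Q * (β1 - β2) = 0 := by linear_combination -A0
    exact sub_eq_zero.mp ((mul_eq_zero.mp h).resolve_left (mul_ne_zero hb hQ.ne'))
  have hS : β0 + β2 = 0 := by
    have e3 : a * P * (β0 + β2) * (1 - s * s) = 0 := by
      linear_combination s * C1 - A1 - (c * R * (β2 - β0)) * hsinv
    rcases mul_eq_zero.mp e3 with h | h
    · exact (mul_eq_zero.mp h).resolve_left (mul_ne_zero ha hP.ne')
    · exact absurd h hss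
  have hD : β2 - β0 = 0 := by
    have h : c * R * (β2 - β0) = 0 := by linear_combination A1 + (a * P) * hS
    exact (mul_eq_zero.mp h).resolve_left (mul_ne_zero hc hR.ne')
  refine ⟨rfl, rfl, rfl, ?_, ?_, ?_⟩ <;> linarith

/-- `(t e₀)₀ = t`. [folklore] -/
private theorem smul_single_zero_apply_zero (t : ℝ) : (t • (𝐞 0) : ℝ³) 0 = t := by simp
/-- `(t e₀)₁ = 0`. [folklore] -/
private theorem smul_single_zero_apply_one (t : ℝ) : (t • (𝐞 0) : ℝ³) 1 = 0 := by simp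
/-- `(t e₀)₂ = 0`. [folklore] -/
private theorem smul_single_zero_apply_two (t : ℝ) : (t • (𝐞 0) : ℝ³) 2 = 0 := by simp
/-- `(t e₁)₀ = 0`. [folklore] -/
private theorem smul_single_one_apply_zero (t : ℝ) : (t • (𝐞 1) : ℝ³) 0 = 0 := by simp
/-- `(t e₁)₁ = t`. [folklore] -/
private theorem smul_single_one_apply_one (t : ℝ) : (t • (𝐞 1) : ℝ³) 1 = t := by simp
/-- `(t e₁)₂ = 0`. [folklore] -/
private theorem smul_single_one_apply_two (t : ℝ) : (t • (𝐞 1) : ℝ³) 2 = 0 := by simp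

/-- **No continuous Euclidean symmetry of the vorticity.** For non-zero amplitudes, NO Killing field
`K(y) = Ω × (y − q) + β` of `ℝ³` (`(Ω, β) ≠ 0`: translations along any line, rotations and screw motions about any
axis) leaves the vorticity `ω = curl v` of the crossed-layers flow invariant on any non-empty open set:
`L_K ω = Dω[K] − Ω × ω` is non-zero somewhere in `U`.  In particular the flow lies in none of the settled symmetric
strata of the crux (vorticity translation-invariant along a line; axisymmetric about an axis). [folklore] -/
theorem exists_killing_defect (ha : a ≠ 0) (hb : b ≠ 0) (hc : c ≠ 0) {Ω β : ℝ³} (hΩβ : Ω ≠ 0 ∨ β ≠ 0)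
    (q : ℝ³) {U : Set ℝ³} (hU : IsOpen U) (hne : U.Nonempty) :
    ∃ y ∈ U, fderiv ℝ (curl (crossField a b c)) y (cross Ω (y - q) + β) ≠
      cross Ω (curl (crossField a b c) y) := by
  by_contra hcon
  push Not at hcon
  obtain ⟨y, hy⟩ := hne
  obtain ⟨ε, hε, hball⟩ := Metric.isOpen_iff.mp hU y hy
  set t : ℝ := ε / 3 with ht
  have ht0 : 0 < t := by positivity
  have hnorm : ∀ j : Fin 3, ‖t • (𝐞 j)‖ = t := fun j => by
    simp [norm_smul, Real.norm_of_nonneg ht0.le]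
  have m1 : y + t • (𝐞 1) ∈ U := hball (by
    rw [Metric.mem_ball, dist_eq_norm, add_sub_cancel_left, hnorm]; linarith)
  have m0 : y + t • (𝐞 0) ∈ U := hball (by
    rw [Metric.mem_ball, dist_eq_norm, add_sub_cancel_left, hnorm]; linarith)
  have m01 : y + t • (𝐞 0) + t • (𝐞 1) ∈ U := hball (by
    rw [Metric.mem_ball, dist_eq_norm, add_assoc, add_sub_cancel_left]
    calc ‖t • (𝐞 0) + t • (𝐞 1)‖ ≤ ‖t • (𝐞 0)‖ + ‖t • (𝐞 1)‖ := norm_add_le _ _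
      _ = t + t := by rw [hnorm, hnorm]
      _ < ε := by linarith)
  have H : ∀ z ∈ U, ∀ i : Fin 3, fderiv ℝ (curl (crossField a b c)) z (cross Ω (z - q) + β) i =
      cross Ω (curl (crossField a b c) z) i := fun z hz i => by rw [hcon z hz]
  have A0 := H y hy 0
  have A1 := H y hy 1
  have A2 := H y hy 2
  have B0 := H _ m1 0
  have B2 := H _ m1 2
  have C0 := H _ m0 0
  have C1 := H _ m0 1
  have C2 := H _ m0 2
  have D0 := H _ m01 0
  simp only [fderiv_curl_crossField_apply_zero, fderiv_curl_crossField_apply_one,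
    fderiv_curl_crossField_apply_two, curl_crossField, vort_apply_zero, vort_apply_one, vort_apply_two,
    cross_apply_zero, cross_apply_one, cross_apply_two, PiLp.add_apply, PiLp.sub_apply,
    E₁_add_single_zero, E₂_add_single_zero, E₃_add_single_zero, E₁_add_single_one,
    E₂_add_single_one, E₃_add_single_one, smul_single_zero_apply_zero, smul_single_zero_apply_one,
    smul_single_zero_apply_two, smul_single_one_apply_zero, smul_single_one_apply_one,
    smul_single_one_apply_two] at A0 A1 A2 B0 B2 C0 C1 C2 D0
  have hs1 : exp t ≠ 1 := by rw [ne_eq, exp_eq_one_iff]; exact ht0.ne'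
  obtain ⟨h0, h1, h2, h3, h4, h5⟩ := killing_algebra (Ω0 := Ω 0) (Ω1 := Ω 1) (Ω2 := Ω 2) (β0 := β 0)
    (β1 := β 1) (β2 := β 2) (y0 := y 0) (y1 := y 1) (y2 := y 2) (q0 := q 0) (q1 := q 1) (q2 := q 2)
    ha hb hc (E₁_pos y) (E₂_pos y) (E₃_pos y) (exp_pos t) hs1 ht0.ne'
    (by linear_combination A2) (by linear_combination B2) (by linear_combination C2)
    (by linear_combination A0) (by linear_combination B0) (by linear_combination C0)
    (by linear_combination D0) (by linear_combination A1) (by linear_combination C1)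
  rcases hΩβ with hΩ | hβ
  · exact hΩ (by ext i; fin_cases i <;> simp [h0, h1, h2])
  · exact hβ (by ext i; fin_cases i <;> simp [h3, h4, h5])

/-- `0 × v = 0`. [folklore] -/
private theorem cross_zero_left (v : ℝ³) : cross (0 : ℝ³) v = 0 := by
  ext i; fin_cases i <;> simp [cross_apply_zero, cross_apply_one, cross_apply_two]

/-- `e₂ × v = Jv` (the rotation generator `rotGen`). [folklore] -/
private theorem cross_single_two (v : ℝ³) : cross (𝐞 2) v = rotGen v := by
  ext i; fin_cases i <;> simp [cross_apply_zero, cross_apply_one, cross_apply_two, rotGen]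

/-- **Not in stratum (A), locally**: for every direction `e ≠ 0` and every non-empty open `U` the vorticity is NOT
translation-invariant along `e` on `U` — `∂_e ω ≠ 0` somewhere in `U` (the negation of the local hypothesis shape
`∀ y ∈ U, fderiv ℝ (curl v) y e = 0` of `…LocalVorticitySymmetry`). [folklore] -/
theorem exists_translation_defect (ha : a ≠ 0) (hb : b ≠ 0) (hc : c ≠ 0) {e : ℝ³} (he : e ≠ 0)
    {U : Set ℝ³} (hU : IsOpen U) (hne : U.Nonempty) :
    ∃ y ∈ U, fderiv ℝ (curl (crossField a b c)) y e ≠ 0 := by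
  obtain ⟨y, hy, h⟩ := exists_killing_defect a b c ha hb hc (Ω := 0) (β := e) (Or.inr he) 0 hU hne
  refine ⟨y, hy, ?_⟩
  simpa [cross_zero_left] using h

/-- **Not in stratum (A′), locally**: for every vertical axis `{x_h = q_h}` and every non-empty open `U` the
vorticity is NOT infinitesimally axisymmetric about that axis on `U` (the negation of the hypothesis shape
`fderiv ℝ (curl v) y (rotGen (y − c)) = rotGen (curl v y)` of `…LocalVorticitySymmetry`; all other axes are covered
by `exists_killing_defect`). [folklore] -/
theorem exists_rotation_defect (ha : a ≠ 0) (hb : b ≠ 0) (hc : c ≠ 0) (q : ℝ³)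
    {U : Set ℝ³} (hU : IsOpen U) (hne : U.Nonempty) :
    ∃ y ∈ U, fderiv ℝ (curl (crossField a b c)) y (rotGen (y - q)) ≠ rotGen (curl (crossField a b c) y) := by
  obtain ⟨y, hy, h⟩ :=
    exists_killing_defect a b c ha hb hc (Ω := 𝐞 2) (β := 0) (Or.inl (by simp)) q hU hne
  refine ⟨y, hy, ?_⟩
  simpa [cross_single_two] using h

/-- **Not in stratum (A), globally** (the literal hypothesis shape of the settled stratum theorem
`…VorticityTranslate.eq_zero_of_curl_translate_eq_slice`, negated for this steady field): the vorticity is not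
invariant under the translations along any `e ≠ 0`. [folklore] -/
theorem not_curl_translate_invariant (ha : a ≠ 0) (hb : b ≠ 0) (hc : c ≠ 0) {e : ℝ³} (he : e ≠ 0) :
    ¬ ∀ (y : ℝ³) (l : ℝ), curl (crossField a b c) (y + l • e) = curl (crossField a b c) y := by
  intro h
  obtain ⟨y, -, hy⟩ := exists_translation_defect a b c ha hb hc he isOpen_univ univ_nonempty
  apply hy
  have hline : HasDerivAt (fun l : ℝ => y + l • e) e 0 := by
    simpa using ((hasDerivAt_id (0 : ℝ)).smul_const e).const_add y
  have hcomp : HasDerivAt (fun l : ℝ => curl (crossField a b c) (y + l • e))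
      (fderiv ℝ (curl (crossField a b c)) y e) 0 := by
    have hF : HasFDerivAt (curl (crossField a b c)) (fderiv ℝ (curl (crossField a b c)) y) (y + (0 : ℝ) • e) := by
      rw [zero_smul, add_zero, curl_crossField_eq]
      exact (hasFDerivAt_vort a b c y).differentiableAt.hasFDerivAt
    exact hF.comp_hasDerivAt (0 : ℝ) hline
  have hconst : HasDerivAt (fun l : ℝ => curl (crossField a b c) (y + l • e)) 0 0 := by
    have e' : (fun l : ℝ => curl (crossField a b c) (y + l • e)) = fun _ => curl (crossField a b c) y :=
      funext fun l => h y l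
    rw [e']
    exact hasDerivAt_const 0 _
  exact hcomp.unique hconst

end CrossedLayers

end Summit.NavierStokesRegularity.NavierStokesRegularity.Theorems.PoloidalWindowRigidity.Negative
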